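import Literature.Geometry.DiscreteGeometry.ShellCensusSearchGrowth
import HarnessLib

/-!
# Soundness of the census growth search, part B2: the root and one growth step

Topic `Literature/Geometry/DiscreteGeometry`.  What `chooseOpen` says, the realized root of
every frame, the budget bound, and the completeness of one growth step (`expand_branch`).
-/

namespace Literature.Geometry.DiscreteGeometry

namespace ShellCensusSearch

open Finset

/-! ### The open side -/

/-- What `chooseOpen = some (p, q)` says. [folklore] -/
theorem chooseOpen_some {s : St} {p q : ℕ} (h : s.chooseOpen = some (p, q)) :
    p < q ∧ q < s.n ∧ s.gsc p q = 1 := by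
  unfold St.chooseOpen at h
  obtain ⟨p', _, hp'⟩ := List.exists_of_findSome?_eq_some h
  rw [Option.map_eq_some_iff] at hp'
  obtain ⟨q', hq', he⟩ := hp'
  simp only [Prod.mk.injEq] at he
  obtain ⟨rfl, rfl⟩ := he
  have h1 := List.find?_some hq'
  have h2 := List.mem_of_find?_eq_some hq'
  simp only [Bool.and_eq_true, decide_eq_true_eq, beq_iff_eq] at h1
  exact ⟨h1.1, by simpa using h2, h1.2⟩

/-- What `chooseOpen = none` says: no side count of two used labels is one. [folklore] -/
theorem chooseOpen_none {s : St} (h : s.chooseOpen = none) {a b : ℕ} (ha : a < s.n) (hb : b < s.n) (hab : a ≠ b) :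
    s.gsc a b ≠ 1 := by
  unfold St.chooseOpen at h
  rw [List.findSome?_eq_none_iff] at h
  have key : ∀ p q, p < s.n → q < s.n → p < q → s.gsc p q ≠ 1 := by
    intro p q hp hq hpq he
    have h1 := h p (by simpa using hp)
    rw [Option.map_eq_none_iff, List.find?_eq_none] at h1
    have h2 := h1 q (by simpa using hq)
    simp [hpq, he] at h2
  rcases Nat.lt_or_gt_of_ne hab with hlt | hlt
  · exact key a b ha hb hlt
  · rw [gsc_comm]; exact key b a hb ha hlt

/-! ### The realized root -/

/-- Decoding the root code. [folklore] -/
theorem root_code : tv0 (triCode 0 1 2) = 0 ∧ tv1 (triCode 0 1 2) = 1 ∧ tv2 (triCode 0 1 2) = 2 := by decide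

/-- **Every frame realizes one of the two roots.** [folklore] -/
theorem exists_realizes_root (M : CF) : ∃ (φ : ℕ → Fin 12) (m0 : ℕ), (m0 = 4 ∨ m0 = 5) ∧ Realizes M φ (mkRoot m0) := by
  classical
  obtain ⟨v₀, hmin, h4, h5⟩ := CF.exists_min_star (M := M)
  -- a bond partner x of v₀
  have hpos : 0 < (Finset.univ.filter fun w => M.bond v₀ w = true).card := by rw [M.bond_four]; norm_num
  obtain ⟨x, hx⟩ := card_pos.1 hpos
  rw [mem_filter] at hx
  have hbx : M.bond v₀ x = true := hx.2
  have hvx : v₀ ≠ x := CF.ne_of_bond hbx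
  -- a triangle T through v₀, x and its third vertex y
  have h2 := M.bond_side v₀ x hbx
  have hpos' : 0 < (M.tri.filter fun S' => ({v₀, x} : Finset (Fin 12)) ⊆ S').card := by rw [h2]; norm_num
  obtain ⟨T, hT⟩ := card_pos.1 hpos'
  rw [mem_filter] at hT
  have hT3 := M.tri_card T hT.1
  have hvT : v₀ ∈ T := hT.2 (by simp)
  have hxT : x ∈ T := hT.2 (by simp)
  obtain ⟨y, hyT, hyv, hyx⟩ : ∃ y ∈ T, y ≠ v₀ ∧ y ≠ x := by
    have : (T.erase v₀).erase x |>.Nonempty := by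
      rw [← card_pos, card_erase_of_mem (mem_erase.2 ⟨hvx.symm, hxT⟩), card_erase_of_mem hvT, hT3]; norm_num
    obtain ⟨y, hy⟩ := this
    simp only [mem_erase] at hy
    exact ⟨y, hy.2.2, hy.2.1, hy.1⟩
  have hTeq : T = {v₀, x, y} := by
    symm
    apply eq_of_subset_of_card_le
    · intro z hz; simp only [mem_insert, mem_singleton] at hz; rcases hz with rfl | rfl | rfl <;> assumption
    · rw [hT3, card_insert_of_notMem, card_insert_of_notMem, card_singleton]
      · simpa using hyx.symm
      · simp only [mem_insert, mem_singleton, not_or]; exact ⟨hvx, hyv.symm⟩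
  let φ : ℕ → Fin 12 := fun k => if k = 0 then v₀ else if k = 1 then x else y
  have φ0 : φ 0 = v₀ := rfl
  have φ1 : φ 1 = x := rfl
  have φ2 : φ 2 = y := rfl
  refine ⟨φ, (M.star v₀).card, by omega, ?_⟩
  have htris : (mkRoot (M.star v₀).card).tris.toList = [triCode 0 1 2] := rfl
  have hvalid : TriValid (triCode 0 1 2) 3 := by unfold TriValid; decide
  have hlset : lset (triCode 0 1 2) = {0, 1, 2} := by unfold lset; decide
  have htset : tset φ (triCode 0 1 2) = T := by
    rw [hTeq, tset, hlset]; simp [φ]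
  have hinj : ∀ p q, p < 3 → q < 3 → φ p = φ q → p = q := by
    intro p q hp hq he
    interval_cases p <;> interval_cases q <;> simp_all [φ]
  have hcl : ∀ v, (mkRoot (M.star v₀).card).isCl v = false := by
    intro v
    simp only [St.isCl, mkRoot]
    rw [getD_replicate]; rfl
  have hgb : ∀ a b, (mkRoot (M.star v₀).card).ggb a b = if sIdx a b = sIdx 0 1 then 2 else 0 := by
    intro a b
    have h144 : sIdx 0 1 < (Array.replicate 144 0 : Array ℕ).size := by simp [sIdx]
    simp only [St.ggb, mkRoot]
    rw [getD_setIfInBounds _ _ _ _ h144, getD_replicate]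
  exact
    { n_le := by change 3 ≤ 12; norm_num
      three_le := le_rfl
      m0_eq := by rw [φ0]; rfl
      m0_min := hmin
      bond01 := by rw [φ0, φ1]; exact hbx
      inj := hinj
      valid := by intro t ht; rw [htris, List.mem_singleton] at ht; subst ht; exact hvalid
      mem := by intro t ht; rw [htris, List.mem_singleton] at ht; subst ht; rw [htset]; exact hT.1
      nodup := by rw [htris]; exact List.nodup_singleton _
      used := by
        intro v hv; change v < 3 at hv
        refine ⟨triCode 0 1 2, by rw [htris]; simp, ?_⟩
        interval_cases v <;> decide
      gb_sem0 := hgb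
      gb_size := by simp only [mkRoot, Array.size_setIfInBounds, Array.size_replicate]
      cl_size := by simp only [mkRoot, Array.size_replicate]
      cl_lt := by intro v hv; rw [hcl] at hv; exact absurd hv Bool.false_ne_true
      cl_sem := by intro v hv; rw [hcl] at hv; exact absurd hv Bool.false_ne_true }

/-! ### One growth step -/

namespace Realizes

variable {M : CF} {φ : ℕ → Fin 12} {s : St}

/-- Relabellings agreeing on the labels of a code give the same image. [folklore] -/
theorem tset_congr {φ' : ℕ → Fin 12} {t : ℕ} (h : ∀ w ∈ lset t, φ' w = φ w) : tset φ' t = tset φ t := by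
  unfold tset; exact image_congr fun w hw => h w (by simpa using hw)

/-- The third vertex of the missing triangle on an open side. [folklore] -/
theorem exists_missing (h : Realizes M φ s) {p q : ℕ} (hpq : p < q) (hq : q < s.n) (h1 : s.gsc p q = 1) :
    ∃ S ∈ M.tri, ∃ z, z ≠ φ p ∧ z ≠ φ q ∧ S = {φ p, φ q, z} ∧ ∀ t ∈ s.tris.toList, tset φ t ≠ S := by
  have hp : p < s.n := lt_trans hpq hq
  have hne : p ≠ q := Nat.ne_of_lt hpq
  obtain ⟨S, hS, hpS, hqS, hnot⟩ := h.exists_unplaced_of_gsc_one hp hq hne h1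
  have hS3 := M.tri_card S hS
  have hφ : φ p ≠ φ q := fun e => hne (h.inj p q hp hq e)
  obtain ⟨z, hzS, hzp, hzq⟩ : ∃ z ∈ S, z ≠ φ p ∧ z ≠ φ q := by
    have : (S.erase (φ p)).erase (φ q) |>.Nonempty := by
      rw [← card_pos, card_erase_of_mem (mem_erase.2 ⟨hφ.symm, hqS⟩), card_erase_of_mem hpS, hS3]; norm_num
    obtain ⟨z, hz⟩ := this
    simp only [mem_erase] at hz
    exact ⟨z, hz.2.2, hz.2.1, hz.1⟩
  refine ⟨S, hS, z, hzp, hzq, ?_, hnot⟩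
  symm
  apply eq_of_subset_of_card_le
  · intro w hw; simp only [mem_insert, mem_singleton] at hw; rcases hw with rfl | rfl | rfl <;> assumption
  · rw [hS3, card_insert_of_notMem, card_insert_of_notMem, card_singleton]
    · simpa using hzq.symm
    · simp only [mem_insert, mem_singleton, not_or]; exact ⟨hφ, hzp.symm⟩

/-- With an open side fewer than twenty triangles are placed. [folklore] -/
theorem size_lt_of_open (h : Realizes M φ s) {p q : ℕ} (hpq : p < q) (hq : q < s.n) (h1 : s.gsc p q = 1) :
    s.tris.size < 20 := by
  classical
  obtain ⟨S, hS, z, -, -, -, hnot⟩ := h.exists_missing hpq hq h1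
  have hsub : s.tris.toList.toFinset.image (tset φ) ⊆ M.tri.erase S := by
    intro T hT
    rw [mem_image] at hT
    obtain ⟨t, ht, rfl⟩ := hT
    exact mem_erase.2 ⟨hnot t (by simpa using ht), h.mem t (by simpa using ht)⟩
  have hc := card_le_card hsub
  rw [card_erase_of_mem hS, M.card_tri, card_image_of_injOn, List.toFinset_card_of_nodup h.nodup, Array.length_toList] at hc
  · omega
  · intro t ht t' ht' he
    exact h.eq_of_tset_eq (by simpa using ht) (by simpa using ht') he

/-- The ends of an open side are not closed. [folklore] -/
theorem not_isCl_of_open (h : Realizes M φ s) {p q : ℕ} (hpq : p < q) (hq : q < s.n) (h1 : s.gsc p q = 1) :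
    s.isCl p = false ∧ s.isCl q = false := by
  obtain ⟨S, hS, z, -, -, hSe, hnot⟩ := h.exists_missing hpq hq h1
  constructor
  · by_contra hc
    rw [Bool.not_eq_false] at hc
    obtain ⟨t, ht, he⟩ := h.cl_sem p hc S hS (by rw [hSe]; simp)
    exact hnot t ht he
  · by_contra hc
    rw [Bool.not_eq_false] at hc
    obtain ⟨t, ht, he⟩ := h.cl_sem q hc S hS (by rw [hSe]; simp)
    exact hnot t ht he

/-- **The budget bound**: the star sizes of a frame sum to `60`, and `budget` is a lower
estimate of that sum. [folklore] -/
theorem budget_le (h : Realizes M φ s) : s.budget ≤ 60 := by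
  classical
  -- rewrite the fold as a Finset sum
  set g : ℕ → ℕ := fun v => max 4 ((s.trisAt v).length + (if s.hasOpen v then 1 else 0)) with hg
  have hfold : ∀ k, foldRange (fun acc v => acc + max 4 ((s.trisAt v).length + (if s.hasOpen v then 1 else 0))) 0 k 0 =
      ∑ v ∈ Finset.range k, g v := by
    intro k
    rw [← foldRange_eq]
    suffices hs : ∀ acc, (List.range' 0 k).foldl (fun acc v => acc + max 4 ((s.trisAt v).length + (if s.hasOpen v then 1 else 0))) acc =
        acc + ∑ v ∈ Finset.range k, g v by simpa using hs 0
    induction k with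
    | zero => intro acc; simp
    | succ k ih =>
      intro acc
      rw [List.range'_concat, List.foldl_append, ih, Finset.sum_range_succ]
      simp [hg, add_assoc]
  have hb : s.budget = (∑ v ∈ Finset.range s.n, g v) + 4 * (12 - s.n) := by
    unfold St.budget; rw [hfold]
  rw [hb]
  -- the image of the used labels
  set I : Finset (Fin 12) := (Finset.range s.n).image φ with hI
  have hinj : Set.InjOn φ (Finset.range s.n : Set ℕ) := by
    intro a ha b hb he
    exact h.inj a b (by simpa using ha) (by simpa using hb) he
  have hcardI : I.card = s.n := by rw [hI, card_image_of_injOn hinj, card_range]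
  have hsplit := Finset.sum_sdiff (f := fun u => (M.star u).card) (subset_univ I)
  have htot := CF.sum_card_star (M := M)
  have h1 : ∑ v ∈ Finset.range s.n, g v ≤ ∑ u ∈ I, (M.star u).card := by
    rw [hI, sum_image hinj]
    apply sum_le_sum
    intro v hv
    have hvn : v < s.n := by simpa using hv
    exact max_le (CF.four_le_card_star _) (h.card_star_ge hvn)
  have h2 : 4 * (12 - s.n) ≤ ∑ u ∈ Finset.univ \ I, (M.star u).card := by
    have : 4 * (12 - s.n) = ∑ _u ∈ Finset.univ \ I, 4 := by
      rw [sum_const, smul_eq_mul, card_sdiff_of_subset (subset_univ I), card_univ, Fintype.card_fin, hcardI]; ring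
    rw [this]
    exact sum_le_sum fun u _ => CF.four_le_card_star u
  rw [← hsplit] at htot
  omega

/-- Marking a label closed whose spokes all carry two triangles keeps the state realized.
[folklore] -/
theorem closeOne_sound (h : Realizes M φ s) (v : ℕ) : ∃ s', s.closeOne v = some s' ∧ Realizes M φ s' ∧
    s'.tris = s.tris ∧ s'.n = s.n ∧ s'.m0 = s.m0 ∧ s'.gb = s.gb := by
  unfold St.closeOne
  by_cases hc : (s.isCl v || !s.spokesTwo v) = true
  · exact ⟨s, by simp [hc], h, rfl, rfl, rfl, rfl⟩
  have hc' : s.isCl v = false ∧ s.spokesTwo v = true := by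
    simpa [Bool.or_eq_true] using hc
  have hsp := hc'.2
  unfold St.spokesTwo at hsp
  rw [Bool.and_eq_true] at hsp
  obtain ⟨hne, hall⟩ := hsp
  rw [List.all_eq_true] at hall
  -- v is used
  have hv : v < s.n := by
    have : (s.link v) ≠ [] := by simpa using hne
    obtain ⟨u, hu⟩ := List.exists_mem_of_ne_nil _ this
    obtain ⟨-, -, h0⟩ := (mem_link s v u).1 hu
    obtain ⟨t, ht, htv, -⟩ := exists_of_gsc_ne_zero h0
    exact h.lt_n ht (tmem_iff.1 htv)
  have htwo : ∀ u, u < s.n → u ≠ v → s.gsc v u ≠ 0 → s.gsc v u = 2 := by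
    intro u hu huv h0
    have := hall u ((mem_link s v u).2 ⟨hu, huv, h0⟩)
    simpa using this
  have hplaced := h.star_placed hv htwo
  have hcard := h.card_star_eq_of_placed hv hplaced
  have hm0 : ¬ ((s.trisAt v).length < s.m0 ∨ (v = 0 ∧ (s.trisAt v).length ≠ s.m0)) := by
    push Not
    refine ⟨by rw [← hcard]; exact h.m0_min _, fun hv0 => ?_⟩
    subst hv0; rw [← hcard, h.m0_eq]
  refine ⟨{ s with cl := s.cl.setIfInBounds v 1 }, by simp [hc, hm0], ?_, rfl, rfl, rfl, rfl⟩
  have hv12 : v < s.cl.size := by rw [h.cl_size]; have := h.n_le; omega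
  have hcl : ∀ w, St.isCl { s with cl := s.cl.setIfInBounds v 1 } w = (if w = v then true else s.isCl w) := by
    intro w
    simp only [St.isCl, getD_setIfInBounds _ _ _ _ hv12]
    split <;> simp
  exact
    { n_le := h.n_le
      three_le := h.three_le
      m0_eq := h.m0_eq
      m0_min := h.m0_min
      bond01 := h.bond01
      inj := h.inj
      valid := h.valid
      mem := h.mem
      nodup := h.nodup
      used := h.used
      gb_sem0 := h.gb_sem0
      gb_size := h.gb_size
      cl_size := by simp [Array.size_setIfInBounds, h.cl_size]
      cl_lt := by
        intro w hw; rw [hcl] at hw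
        by_cases hwv : w = v
        · subst hwv; exact hv
        · rw [if_neg hwv] at hw; exact h.cl_lt w hw
      cl_sem := by
        intro w hw; rw [hcl] at hw
        by_cases hwv : w = v
        · subst hwv; exact hplaced
        · rw [if_neg hwv] at hw; exact h.cl_sem w hw }

/-- Closing a list of labels keeps the state realized. [folklore] -/
theorem closeAll_sound (h : Realizes M φ s) (L : List ℕ) : ∃ s', s.closeAll L = some s' ∧ Realizes M φ s' ∧
    s'.tris = s.tris ∧ s'.n = s.n ∧ s'.m0 = s.m0 ∧ s'.gb = s.gb := by
  induction L generalizing s with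
  | nil => exact ⟨s, rfl, h, rfl, rfl, rfl, rfl⟩
  | cons v L ih =>
    obtain ⟨s1, h1, hR1, e1, e2, e3, e4⟩ := h.closeOne_sound v
    obtain ⟨s2, h2, hR2, f1, f2, f3, f4⟩ := ih hR1
    refine ⟨s2, ?_, hR2, f1.trans e1, f2.trans e2, f3.trans e3, f4.trans e4⟩
    simp [St.closeAll, h1, h2]

/-- The image of a sorted code of three distinct used labels. [folklore] -/
theorem tset_sortTri (h : Realizes M φ s) {φ' : ℕ → Fin 12} {a b c n : ℕ} (hn : n ≤ 12) (ha : a < n) (hb : b < n)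
    (hc : c < n) (hab : a ≠ b) (hbc : b ≠ c) (hac : a ≠ c) :
    TriValid (sortTri a b c) n ∧ tset φ' (sortTri a b c) = {φ' a, φ' b, φ' c} := by
  have _ := h.n_le
  obtain ⟨hv, hl⟩ := sortTri_spec ha hb hc (by omega) hab hbc hac
  refine ⟨hv, ?_⟩
  rw [tset, hl]; simp [image_insert]

/-- **Growing through an old label keeps the state realized.** [folklore] -/
theorem addTri_old (h : Realizes M φ s) {p q r : ℕ} (hp : p < s.n) (hq : q < s.n) (hr : r < s.n) (hpq : p ≠ q)
    (hqr : q ≠ r) (hpr : p ≠ r) (hS : ({φ p, φ q, φ r} : Finset (Fin 12)) ∈ M.tri)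
    (hnot : sortTri p q r ∉ s.tris.toList) : Realizes M φ (s.addTri p q r) := by
  obtain ⟨hv, htset⟩ := h.tset_sortTri (φ' := φ) h.n_le hp hq hr hpq hqr hpr
  have hlist := addTri_toList s p q r
  exact
    { n_le := h.n_le
      three_le := h.three_le
      m0_eq := h.m0_eq
      m0_min := h.m0_min
      bond01 := h.bond01
      inj := h.inj
      valid := by
        intro t ht; rw [hlist, List.mem_append, List.mem_singleton] at ht
        rcases ht with ht | rfl
        · exact h.valid t ht
        · exact hv
      mem := by
        intro t ht; rw [hlist, List.mem_append, List.mem_singleton] at ht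
        rcases ht with ht | rfl
        · exact h.mem t ht
        · rw [htset]; exact hS
      nodup := by
        rw [hlist, List.nodup_append]
        exact ⟨h.nodup, List.nodup_singleton _, fun t ht t' ht' => by
          rw [List.mem_singleton] at ht'; subst ht'; exact fun e => hnot (e ▸ ht)⟩
      used := by
        intro v hv'
        obtain ⟨t, ht, htv⟩ := h.used v hv'
        exact ⟨t, by rw [hlist]; exact List.mem_append_left _ ht, htv⟩
      gb_sem0 := h.gb_sem0
      gb_size := h.gb_size
      cl_size := h.cl_size
      cl_lt := h.cl_lt
      cl_sem := by
        intro v hv' T hT hvT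
        obtain ⟨t, ht, he⟩ := h.cl_sem v hv' T hT hvT
        exact ⟨t, by rw [hlist]; exact List.mem_append_left _ ht, he⟩ }

/-- A label outside the image of the used labels leaves room: fewer than twelve labels are used.
[folklore] -/
theorem n_lt_of_fresh (h : Realizes M φ s) {z : Fin 12} (hz : ∀ k, k < s.n → φ k ≠ z) : s.n < 12 := by
  classical
  have hinj : Set.InjOn φ (Finset.range s.n : Set ℕ) := by
    intro a ha b hb he
    exact h.inj a b (by simpa using ha) (by simpa using hb) he
  have hsub : (Finset.range s.n).image φ ⊆ Finset.univ.erase z := by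
    intro w hw
    rw [mem_image] at hw
    obtain ⟨k, hk, rfl⟩ := hw
    exact mem_erase.2 ⟨hz k (by simpa using hk), mem_univ _⟩
  have hc := card_le_card hsub
  rw [card_image_of_injOn hinj, card_range, card_erase_of_mem (mem_univ z), card_univ, Fintype.card_fin] at hc
  omega

/-- **Growing through a new label keeps the state realized** (the labelling is extended by the
fresh vertex). [folklore] -/
theorem addTri_new (h : Realizes M φ s) {p q : ℕ} (hp : p < s.n) (hq : q < s.n) (hpq : p ≠ q) {z : Fin 12}
    (hz : ∀ k, k < s.n → φ k ≠ z) (hS : ({φ p, φ q, z} : Finset (Fin 12)) ∈ M.tri) :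
    Realizes M (fun k => if k = s.n then z else φ k) { s.addTri p q s.n with n := s.n + 1 } := by
  set φ' : ℕ → Fin 12 := fun k => if k = s.n then z else φ k with hφ'
  have hnlt := h.n_lt_of_fresh hz
  have h3 := h.three_le
  have agree : ∀ k, k < s.n → φ' k = φ k := fun k hk => by simp [hφ', Nat.ne_of_lt hk]
  have hnew : φ' s.n = z := by simp [hφ']
  have hpn : p ≠ s.n := Nat.ne_of_lt hp
  have hqn : q ≠ s.n := Nat.ne_of_lt hq
  obtain ⟨hv, htset⟩ := h.tset_sortTri (φ' := φ') (n := s.n + 1) (by omega) (Nat.lt_succ_of_lt hp)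
    (Nat.lt_succ_of_lt hq) (Nat.lt_succ_self _) hpq hqn hpn
  have hlist : (({ s.addTri p q s.n with n := s.n + 1 } : St)).tris.toList = s.tris.toList ++ [sortTri p q s.n] :=
    addTri_toList s p q s.n
  have hold : ∀ t ∈ s.tris.toList, tset φ' t = tset φ t := fun t ht =>
    tset_congr fun w hw => agree w (h.lt_n ht hw)
  have hnot : sortTri p q s.n ∉ s.tris.toList := by
    intro hm
    have := h.lt_n hm (show s.n ∈ lset (sortTri p q s.n) by
      rw [(sortTri_spec (n := s.n + 1) (Nat.lt_succ_of_lt hp) (Nat.lt_succ_of_lt hq) (Nat.lt_succ_self _)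
        (by omega) hpq hqn hpn).2]; simp)
    omega
  exact
    { n_le := by change s.n + 1 ≤ 12; omega
      three_le := by change 3 ≤ s.n + 1; omega
      m0_eq := by rw [agree 0 (by omega)]; exact h.m0_eq
      m0_min := h.m0_min
      bond01 := by rw [agree 0 (by omega), agree 1 (by omega)]; exact h.bond01
      inj := by
        intro a b ha hb he
        change a < s.n + 1 at ha; change b < s.n + 1 at hb
        rcases Nat.lt_succ_iff_lt_or_eq.1 ha with ha' | rfl <;> rcases Nat.lt_succ_iff_lt_or_eq.1 hb with hb' | rfl
        · rw [agree a ha', agree b hb'] at he; exact h.inj a b ha' hb' he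
        · rw [agree a ha', hnew] at he; exact absurd he (hz a ha')
        · rw [hnew, agree b hb'] at he; exact absurd he.symm (hz b hb')
        · rfl
      valid := by
        intro t ht; rw [hlist, List.mem_append, List.mem_singleton] at ht
        rcases ht with ht | rfl
        · exact (h.valid t ht).mono (Nat.le_succ _)
        · exact hv
      mem := by
        intro t ht; rw [hlist, List.mem_append, List.mem_singleton] at ht
        rcases ht with ht | rfl
        · rw [hold t ht]; exact h.mem t ht
        · rw [htset, agree p hp, agree q hq, hnew]; exact hS
      nodup := by
        rw [hlist, List.nodup_append]
        exact ⟨h.nodup, List.nodup_singleton _, fun t ht t' ht' => by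
          rw [List.mem_singleton] at ht'; subst ht'; exact fun e => hnot (e ▸ ht)⟩
      used := by
        intro v hv'
        change v < s.n + 1 at hv'
        rcases Nat.lt_succ_iff_lt_or_eq.1 hv' with hv'' | rfl
        · obtain ⟨t, ht, htv⟩ := h.used v hv''
          exact ⟨t, by rw [hlist]; exact List.mem_append_left _ ht, htv⟩
        · refine ⟨sortTri p q s.n, by rw [hlist]; simp, tmem_iff.2 ?_⟩
          rw [(sortTri_spec (n := s.n + 1) (Nat.lt_succ_of_lt hp) (Nat.lt_succ_of_lt hq) (Nat.lt_succ_self _)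
            (by omega) hpq hqn hpn).2]; simp
      gb_sem0 := h.gb_sem0
      gb_size := h.gb_size
      cl_size := h.cl_size
      cl_lt := fun v hv' => Nat.lt_succ_of_lt (h.cl_lt v hv')
      cl_sem := by
        intro v hv' T hT hvT
        have hvn := h.cl_lt v hv'
        rw [agree v hvn] at hvT
        obtain ⟨t, ht, he⟩ := h.cl_sem v hv' T hT hvT
        exact ⟨t, by rw [hlist]; exact List.mem_append_left _ ht, by rw [hold t ht]; exact he⟩ }

/-- **Completeness of one growth step**: a realized state with an open side expands to a branch
containing a realized child. [folklore] -/
theorem expand_branch (h : Realizes M φ s) {p q : ℕ} (hopen : s.chooseOpen = some (p, q)) :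
    ∃ kids, s.expand = .branch kids ∧ ∃ s' ∈ kids, ∃ φ', Realizes M φ' s' := by
  classical
  obtain ⟨hpq, hqn, h1⟩ := chooseOpen_some hopen
  have hpn : p < s.n := lt_trans hpq hqn
  have hne : p ≠ q := Nat.ne_of_lt hpq
  have hsize := h.size_lt_of_open hpq hqn h1
  obtain ⟨hclp, hclq⟩ := h.not_isCl_of_open hpq hqn h1
  obtain ⟨S, hS, z, hzp, hzq, hSe, hnot⟩ := h.exists_missing hpq hqn h1
  -- the kids list
  unfold St.expand
  rw [hopen]
  simp only [Nat.not_le.2 hsize, hclp, hclq, Bool.false_or, Bool.false_eq_true, ↓reduceIte]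
  refine ⟨_, rfl, ?_⟩
  by_cases hzold : ∃ r, r < s.n ∧ φ r = z
  · -- old label r
    obtain ⟨r, hrn, rfl⟩ := hzold
    have hrp : r ≠ p := fun e => hzp (by rw [e])
    have hrq : r ≠ q := fun e => hzq (by rw [e])
    have hS' : ({φ p, φ q, φ r} : Finset (Fin 12)) ∈ M.tri := hSe ▸ hS
    -- r is not closed, the triangle is not placed, both new sides have room
    have hclr : s.isCl r = false := by
      by_contra hc; rw [Bool.not_eq_false] at hc
      obtain ⟨t, ht, he⟩ := h.cl_sem r hc S hS (by rw [hSe]; simp)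
      exact hnot t ht he
    have hplaced : s.placed p q r = false := by
      by_contra hc; rw [Bool.not_eq_false, placed_iff] at hc
      obtain ⟨-, htset⟩ := h.tset_sortTri (φ' := φ) h.n_le hpn hqn hrn hne hrq.symm hrp.symm
      exact hnot _ hc (by rw [htset, hSe])
    have hpr : ¬ 2 ≤ s.gsc p r := by
      intro h2
      have h2' : s.gsc p r = 2 := le_antisymm (h.gsc_le_two hpn hrn hrp.symm) h2
      obtain ⟨t, ht, he⟩ := h.placed_of_gsc_two hpn hrn hrp.symm h2' hS (by rw [hSe]; simp) (by rw [hSe]; simp)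
      exact hnot t ht he
    have hqr : ¬ 2 ≤ s.gsc q r := by
      intro h2
      have h2' : s.gsc q r = 2 := le_antisymm (h.gsc_le_two hqn hrn hrq.symm) h2
      obtain ⟨t, ht, he⟩ := h.placed_of_gsc_two hqn hrn hrq.symm h2' hS (by rw [hSe]; simp) (by rw [hSe]; simp)
      exact hnot t ht he
    -- the child
    have hR1 : Realizes M φ (s.addTri p q r) := h.addTri_old hpn hqn hrn hne hrq.symm hrp.symm hS'
      (fun hm => by rw [← placed_iff] at hm; rw [hm] at hplaced; exact Bool.noConfusion hplaced)
    obtain ⟨s2, hs2, hR2, -, -, -, -⟩ := hR1.closeAll_sound [p, q, r]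
    have hkids : s.kidsAt p q r = some s2 := by
      unfold St.kidsAt
      have hb := hR1.budget_le
      simp [Nat.ne_of_lt hrn, Nat.not_lt.2 hb, hs2]
    refine ⟨s2, List.mem_append_left _ ?_, φ, hR2⟩
    rw [List.mem_filterMap]
    refine ⟨r, ?_, hkids⟩
    rw [List.mem_filter]
    refine ⟨by simpa using hrn, ?_⟩
    simp [hrp, hrq, hclr, hplaced, hpr, hqr]
  · -- new label
    push Not at hzold
    have hz : ∀ k, k < s.n → φ k ≠ z := fun k hk e => hzold k hk e
    have hnlt := h.n_lt_of_fresh hz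
    have hS' : ({φ p, φ q, z} : Finset (Fin 12)) ∈ M.tri := hSe ▸ hS
    have hR1 := h.addTri_new hpn hqn hne hz hS'
    obtain ⟨s2, hs2, hR2, -, -, -, -⟩ := hR1.closeAll_sound [p, q, s.n]
    have hkids : s.kidsAt p q s.n = some s2 := by
      unfold St.kidsAt
      have hb := hR1.budget_le
      simp [Nat.not_lt.2 hb, hs2]
    refine ⟨s2, List.mem_append_right _ ?_, _, hR2⟩
    simp [hnlt, hkids]

end Realizes

end ShellCensusSearch

end Literature.Geometry.DiscreteGeometry
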